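import Summits.QuantumFields.BalabanUV.T4Continuum.Support.NE7SliceIterationStateNL
import Summits.QuantumFields.BalabanUV.T4Continuum.Support.NE7SliceIterationStateFacts
import Summits.QuantumFields.BalabanUV.T4Continuum.Support.NE7SliceTangentPartLimitNL
import Summits.QuantumFields.BalabanUV.T4Continuum.Support.NE7FrameDefectLipschitz
import Summits.QuantumFields.BalabanUV.T4Continuum.Support.NE3CurvedFrameKill
import Summits.QuantumFields.BalabanUV.T4Continuum.Support.BlockAverageCurrent
import Summits.QuantumFields.BalabanUV.T4Continuum.Spine.NE3.FrameNormalisationAdmissibleTop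
import HarnessLib

/-!
# NE7SliceIterationStateFactsNL — THE STATE MAPS OF THE (S1) ITERATION ON THE NONLINEAR FRAME TARGET, ON THE WORKING REGION (memo ROAD-G103 §3, (R1′), file (B2)-2): the frame defect
# `P(u)` is skew, `N`-periodic and `≤ C_Γ(M·b)²`; `h̃(u) = h(u) − P(u)` is skew and `N`-periodic; `φ̃(u)` skew periodic; `T̃(u)` skew periodic with `dirIter T̃(u) = gaugeDir_V h̃(u)`; the normalised split
# of `(T̃(u), h̃(u))` EXISTS; access letters `‖framePotW T̃(u) − h̃(u)‖ ≤ m̃(u)`, `‖gaugeDir W ζ̃(u)‖ ≤ δ̃(u)`, and `‖ζ̃(u)‖ ≤ 6dM·D̃f(u)` — `NE7SliceIterationStateFacts` VERBATIM under `h ↦ h̃`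

Cell `pub-balaban`, rung (B)+1 sub-cell t4, lineage `b2b-balaban-t4-ne7-p1`, generation 103 (CRUX PROVER NE7 #1 = OWNER of BINDER row NE7).  Memo `t4/b2b-balaban-t4-ne7-p1-g103/ROAD-G103.md` §3.
WORKING REGION as in `NE7SliceIterationStateFacts` (unitary `(tower)`-periodic `u`, chart `U′^{u} = W·e^{X(u)}` with `‖X(u)‖ ≤ 1∕8`, corners `u(M•z) = e^{h(u) z}` with `‖h(u)‖ ≤ 1∕8`, `W`, `U′` unitary
`(tower)`-periodic, `W` in the multi-level small-field class with `cruxC·M²x < 1`) PLUS, for the facts about `P(u)` (which read [Balaban1985Averaging] (97)∕(163) and [Balaban1985RegularSpaces] Prop. 7's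
unitarity through `B7Eq162General.eq163_general` ∕ `Spine/NE3/FrameNormalisationAdmissibleTop.vcov_mem_unitaryUnits`), B7's Prop-4 regime at level `k+1` for `W` AND for `U′` and an honest (−1)-size
sup bound `‖X(u)‖ ≤ b` (`2048·d·M·b ≤ 1`); no bridge between the two vocabularies is asserted (as in `NE7SliceNonlinearFrameDefect`).
WHAT ([folklore]; 0 def, 0 sorry).  §1 `relPert_repLog_eq`, `relPert_repLog_mem_unitary`, `relPert_repLog_periodic`, `pdev_relPert_mul_le` (≤ the small-field radius of `U′`), **`frameDefect_skew`**, **`frameDefect_periodic`**,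
**`norm_frameDefect_le`**, `effCornerLog_skew`, `effCornerLog_periodic`, `norm_effCornerLog_le`.  §2 `coarseDatumNL_skew_periodic`, `tangentPartNL_skew`, `tangentPartNL_periodic`,
**`dirIter_tangentPartNL`**, **`splitNL_exists`**, `splitNL_holds`, `frameNL_periodic`, `norm_frame_le_frameMismatchNL`, `norm_gaugeDir_gaugeFunNL_le`, `delta_le_sliceDefectNL`,
**`norm_gaugeFunNL_le`** (`frameMismatchNL_le_sliceDefectNL` is NE7b's `NE7SliceTangentPartLimitNL`, reused by name).
HONEST FRAMING (page 1): bookkeeping over landed letters; nothing of Bałaban's asserted; NOT the one-step contraction, NOT (S1), NOT NE7; spine 0∕9; finite T⁴ rung (B)+1 — NOT infinite volume, NOT mass gap,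
NOT BetaPertH, NOT Clay.  Continuum YM on T⁴ ⇐ BetaPertH ∧ nine spine estimates (0/9 proved); BetaPertH ⇐ (D1) ∧ (D4) ∧ CAP+tail; G-an2-4 gates asym, D1 and NE2/3/4.
-/

set_option autoImplicit false

open scoped BigOperators Matrix.Norms.L2Operator
open NormedSpace Finset

namespace Summit.QuantumFields.BalabanUV.T4Continuum.NE7SliceIterationStateFactsNL

open Literature.MathematicalPhysics.QuantumFieldTheory.Balaban1983to89
open B7Prop1Explicit B7Prop2Explicit B7Prop3Flat MatrixLog
open B7Eq92Concrete (vcov)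
open B7AvgGaugeCovariance (pdev_gaugeAct)
open T4AveragingDeficitWall (IsUnitaryCfg IsSkewDir SmallField vary)
open T4AveragingDeficitWallBoundary (IsPeriodicCfg periodBox)
open T4TermwiseUN (mlog_skew)
open AveragingDeficitPeriodicCounting (IsPeriodicDir)
open AveragingDeficitTwoLevelPrep (prop1Radius)
open AveragingDeficitMultiLevelPrep (cavgIter LevelSmall tower isPeriodicCfg_cavgIter cavgIter_unitary_small)
open AveragingDeficitTransport (mem_U1_of_unitary Ad_mem_skewAdjoint)
open AveragingDeficitKDatum (isUnitaryCfg_gaugeAct)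
open BlockAveragePushDirGauge (gaugeDir isPeriodicDir_gaugeDir)
open BlockAverageCurrent (smallField_gaugeAct)
open NE3EnergyShapes (IsUnitarySite IsPeriodicSite)
open NE3TangentCovariantTower (dirIter framePotW)
open NE3ResidualSliceRep (dirIter_sub isPeriodicCfg_gaugeAct)
open NE3CovariantBlockMean (bmeanIterW)
open NE3QbarIterCovLiftPrep (cruxC)
open NE3SmoothRightInverseW (rightInvW dirIter_rightInvW isSkewDir_rightInvW isPeriodicDir_rightInvW)
open NE3SmoothLiftW (framePotW_add_period)
open NE3FramePotBoundW (tower_eq_pow_mul)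
open NE3LandauOrbit (gaugeDir_skew)
open NE3CurvedFrameKill (framePotW_skew_periodic)
open NE7TangentTransportGauge (dirIter_skew_periodic)
open NE7MeanZeroGaugeSliceW (energyBlockLandauW)
open NE7SliceGaugeFunctionSized (exists_fullGauge_split_sized)
open NE7GaugeFunctionSupLetter (sup_le_of_bmeanIterW_le)
open SpreadLift (loopRad)
open NE3.PairLandauB8Avg (relPert relPert_mul_eq_vary)
open NE3.QbarDictionary (adField relPert_eq_expCfg_adField)
open NE3.FrameNormalisationAdmissibleTop (vcov_add_period vcov_mem_unitaryUnits)
open NE7FrameDefectLipschitz (norm_vcov_relPert_sub_one_le)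
open NE7AccumulatedFrameLinearisation (norm_mlog_vcov_sub_framePotW_le)
open NE7SliceIterationState
open NE7SliceIterationStateFacts (repLog_skew repLog_periodic cornerLog_skew cornerLog_periodic)
open NE7SliceIterationStateNL
open NE7SliceTangentPartLimitNL (frameMismatchNL_le_sliceDefectNL)

noncomputable section

variable {d : ℕ} {n : Type*} [Fintype n] [DecidableEq n]

section Facts

variable [Nonempty n] {L : ℕ} (hL : 2 ≤ L) (k : ℕ) {W : Site d → Fin d → (Matrix n n ℂ)ˣ} {x : ℝ} (hWu : IsUnitaryCfg W) (hx : 0 ≤ x) (hs : LevelSmall d L k x)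
  (hWx : SmallField W x) (N : ℕ) [NeZero N] (hθ : cruxC d L * (((L : ℝ) ^ (k + 1)) ^ 2 * x) < 1) (U' : Site d → Fin d → (Matrix n n ℂ)ˣ)
  (hWP : IsPeriodicCfg W ((tower L N (k + 1) : ℕ) : ℤ)) (hU'u : IsUnitaryCfg U') (hU'P : IsPeriodicCfg U' ((tower L N (k + 1) : ℕ) : ℤ))
  {u : Site d → (Matrix n n ℂ)ˣ} (hu : IsUnitarySite u) (huP : IsPeriodicSite u ((tower L N (k + 1) : ℕ) : ℤ))
  (hgauge : gaugeAct u U' = vary W (repLog W U' u) 1) (hXs : ∀ y κ, ‖repLog W U' u y κ‖ ≤ 1 / 8)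
  (hcorner : ∀ z, ((u (((L : ℤ) ^ (k + 1)) • z) : (Matrix n n ℂ)ˣ) : Matrix n n ℂ) = exp (cornerLog L k u z)) (hhs : ∀ z, ‖cornerLog L k u z‖ ≤ 1 / 8)
  -- B7's Prop-4 regime at level `k+1` for `W` and `U′`, and the (−1)-size sup bound of the chart field (for the facts about `P(u)`)
  (hd : 1 ≤ d) {α₀ αP x' b : ℝ} (hα : 0 < α₀) (hα3 : C0 d * α₀ ≤ 1 / 3) (hα4 : 4 * α₀ ≤ c2' d L) (h52 : pdev W < α₀ * (((L : ℝ) ^ (k + 1))⁻¹) ^ 2)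
  (hb : 0 ≤ b) (hXb : ∀ y κ, ‖repLog W U' u y κ‖ ≤ b)
  (hsmall : Real.exp (4 * (800 * ((d : ℝ) + 1) ^ 2 * ((d : ℝ) + 4)) * α₀) * (1 + 8 * (131072 * ((d : ℝ) + 1) ^ 2) * ((L : ℝ) ^ (k + 1) * b)) ≤ 2)
  (hc₃ : 2 * ((L : ℝ) ^ (k + 1) * b) ≤ c3 d L) (h100 : 100 * ((d : ℝ) * L * ((L : ℝ) ^ (k + 1) * b)) ≤ 1)
  (hC16 : 16 * (131072 * ((d : ℝ) + 1) ^ 2) * ((L : ℝ) ^ (k + 1) * b) ≤ 1) (hsm : 2048 * (d : ℝ) * ((L : ℝ) ^ (k + 1) * b) ≤ 1)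
  (hαP : 0 < αP) (hαP3 : C0 d * αP ≤ 1 / 3) (hαP2 : 2 * αP ≤ c2' d L) (hx' : 0 ≤ x') (hU'x : SmallField U' x') (hx'P : x' < αP * (((L : ℝ) ^ (k + 1))⁻¹) ^ 2)

/-! ## §1 The frame defect `P(u)` and the effective corner logs `h̃(u)` -/

omit [Nonempty n] [NeZero N] in
include hgauge in
/-- the b07 perturbation of the chart IS the regauged datum over `W`: `relPert W X(u) (b) = U′^{u}(b)·W(b)⁻¹`. [folklore] -/
theorem relPert_repLog_eq (y : Site d) (μ : Fin d) : relPert W (repLog W U' u) y μ = gaugeAct u U' y μ * (W y μ)⁻¹ := by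
  have h : relPert W (repLog W U' u) y μ * W y μ = vary W (repLog W U' u) 1 y μ := congrFun (congrFun (relPert_mul_eq_vary W (repLog W U' u)) y) μ
  rw [← hgauge] at h
  rw [← h, mul_inv_cancel_right]

omit [Nonempty n] [NeZero N] in
include hWu hU'u hu hgauge in
/-- `relPert W X(u)` is unitary on the working region. [folklore] -/
theorem relPert_repLog_mem_unitary (y : Site d) (μ : Fin d) : relPert W (repLog W U' u) y μ ∈ unitaryUnits (Matrix n n ℂ) := by
  rw [relPert_repLog_eq U' hgauge]
  exact (unitaryUnits _).mul_mem (isUnitaryCfg_gaugeAct hu hU'u y μ) ((unitaryUnits _).inv_mem (hWu y μ))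

omit [Nonempty n] [NeZero N] in
include hWP hU'P huP in
/-- `relPert W X(u)` is `(tower)`-periodic. [folklore] -/
theorem relPert_repLog_periodic (y : Site d) (μ : Fin d) (j : Fin d) :
    relPert W (repLog W U' u) (y + ((N * L ^ (k + 1) : ℕ) : ℤ) • e j) μ = relPert W (repLog W U' u) y μ := by
  have hT : ((N * L ^ (k + 1) : ℕ) : ℤ) = ((tower L N (k + 1) : ℕ) : ℤ) := by rw [tower_eq_pow_mul]; push_cast; ring
  rw [hT]
  simp only [relPert, repLog_periodic k N U' hWP hU'P huP y j μ, hWP y j μ]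

include hu hgauge hx' hU'x in
/-- the perturbed configuration `relPert W X(u) · W = U′^{u}` has plaquette deviation `≤ x′` (gauge invariance of the small-field class). [folklore] -/
theorem pdev_relPert_mul_le : pdev (expCfg (adField W (repLog W U' u)) * W) ≤ x' := by
  have e : expCfg (adField W (repLog W U' u)) * W = gaugeAct u U' := by
    rw [← relPert_eq_expCfg_adField, hgauge, ← relPert_mul_eq_vary]; rfl
  rw [e]
  have hS := smallField_gaugeAct hu hU'x (U := U')
  -- `pdev ≤` the small-field radius (the diagonal words are trivial)
  unfold pdev
  refine Real.iSup_le (fun p => ?_) hx'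
  rcases eq_or_ne p.2.1 p.2.2 with h | h
  · have h1 : hol (gaugeAct u U') p.1 (plaqWord p.2.1 p.2.2) = 1 := by
      rw [h, B7Prop1Local.hol_plaqWord_eq, mul_inv_cancel_right, mul_inv_cancel]
    rw [h1, Units.val_one, sub_self, norm_zero]
    exact hx'
  · exact hS p.1 p.2.1 p.2.2 h

include hL hWu hx hs hWx hWP hU'u hU'P hu huP hgauge hXs hd hα hα3 hα4 h52 hb hXb hsmall hc₃ hsm hαP hαP3 hαP2 hx' hU'x hx'P in
/-- **`P(u)` IS SKEW** on the working region: `v_{k+1}(X(u))` is unitary ([Balaban1985RegularSpaces] Prop. 7's tower, `vcov_mem_unitaryUnits`) and within `1∕32` of `1` ((163)), so its `mlog` is skew;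
`framePotW X(u)` is skew in the class. [folklore] -/
theorem frameDefect_skew (z : Site d) : frameDefect L k W U' u z ∈ skewAdjoint (Matrix n n ℂ) := by
  have hL1 : 1 ≤ L := by omega
  -- `v` unitary
  have hBu : ∀ (y : Site d) (κ : Fin d), expCfg (adField W (repLog W U' u)) y κ ∈ unitaryUnits (Matrix n n ℂ) := fun y κ => by
    rw [← relPert_eq_expCfg_adField]; exact relPert_repLog_mem_unitary hWu U' hU'u hu hgauge y κ
  have hBsup : ∀ (y : Site d) (κ : Fin d), ‖adField W (repLog W U' u) y κ‖ ≤ b := fun y κ => by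
    unfold adField; rw [AveragingDeficitTransport.norm_Ad_of_unitary (hWu y κ)]; exact hXb y κ
  have hP : pdev (expCfg (adField W (repLog W U' u)) * W) < αP * (((L : ℝ) ^ (k + 1))⁻¹) ^ 2 :=
    lt_of_le_of_lt (pdev_relPert_mul_le U' hu hgauge hx' hU'x) hx'P
  have hv : vcov L W (relPert W (repLog W U' u)) (k + 1) z ∈ unitaryUnits (Matrix n n ℂ) := by
    rw [relPert_eq_expCfg_adField]
    exact vcov_mem_unitaryUnits hd hL hWu hBu hα hα3 hα4 h52 hb hBsup hsmall hc₃ hsm hαP hαP3 hαP2 hP z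
  -- `v` near `1`
  have hnear : ‖((vcov L W (relPert W (repLog W U' u)) (k + 1) z : (Matrix n n ℂ)ˣ) : Matrix n n ℂ) - 1‖ ≤ 1 / 4 := by
    have h := norm_vcov_relPert_sub_one_le hL k hWu hα hα3 hα4 h52 hb hXb hsmall hc₃ hsm z
    have hd0 : (0 : ℝ) ≤ d := Nat.cast_nonneg d
    nlinarith
  have h1 : mlog ((vcov L W (relPert W (repLog W U' u)) (k + 1) z : (Matrix n n ℂ)ˣ) : Matrix n n ℂ) ∈ skewAdjoint (Matrix n n ℂ) :=
    skewAdjoint.mem_iff.mpr (mlog_skew hv hnear)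
  have h2 := (framePotW_skew_periodic (M := N) hL1 k hWu hWP hx hs hWx (repLog_skew hWu U' hU'u hu hgauge hXs) (repLog_periodic k N U' hWP hU'P huP)).1 z
  exact (skewAdjoint _).sub_mem h1 h2

omit [NeZero N] in
include hL hWu hx hs hWx hWP hU'u hU'P hu huP hgauge hXs in
/-- **`P(u)` IS `N`-PERIODIC** (the accumulated frame of periodic data is periodic, `vcov_add_period`; `framePotW` of periodic data is periodic). [folklore] -/
theorem frameDefect_periodic [NeZero N] (z : Site d) (i : Fin d) : frameDefect L k W U' u (z + (N : ℤ) • e i) = frameDefect L k W U' u z := by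
  have hL1 : 1 ≤ L := by omega
  have hT : ((N * L ^ (k + 1) : ℕ) : ℤ) = ((tower L N (k + 1) : ℕ) : ℤ) := by rw [tower_eq_pow_mul]; push_cast; ring
  have hW' : ∀ (y : Site d) (κ : Fin d) (j : Fin d), W (y + ((N * L ^ (k + 1) : ℕ) : ℤ) • e j) κ = W y κ := fun y κ j => by rw [hT]; exact hWP y j κ
  have hv := vcov_add_period L N (k + 1) hW' (fun y κ j => relPert_repLog_periodic k N U' hWP hU'P huP y κ j) z i
  have hF := (framePotW_skew_periodic (M := N) hL1 k hWu hWP hx hs hWx (repLog_skew hWu U' hU'u hu hgauge hXs) (repLog_periodic k N U' hWP hU'P huP)).2 z i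
  simp only [frameDefect, hv, hF]

include hL hWu hα hα3 hα4 h52 hb hXb hsmall hc₃ h100 hC16 in
/-- **`‖P(u)(z)‖ ≤ C_Γ·(M·b)²`**, `C_Γ = 56(dL)² + 16C₁dL` (the sup letter `norm_mlog_vcov_sub_framePotW_le`). [folklore] -/
theorem norm_frameDefect_le (z : Site d) :
    ‖frameDefect L k W U' u z‖ ≤ (56 * ((d : ℝ) * L) ^ 2 + 16 * (131072 * ((d : ℝ) + 1) ^ 2) * ((d : ℝ) * L)) * ((L : ℝ) ^ (k + 1) * b) ^ 2 :=
  norm_mlog_vcov_sub_framePotW_le hL (k + 1) hWu hα hα3 hα4 h52 hb hXb hsmall hc₃ h100 hC16 z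

include hL hWu hx hs hWx hWP hU'u hU'P hu huP hgauge hXs hcorner hhs hd hα hα3 hα4 h52 hb hXb hsmall hc₃ hsm hαP hαP3 hαP2 hx' hU'x hx'P in
/-- **`h̃(u)` IS SKEW** on the working region. [folklore] -/
theorem effCornerLog_skew (z : Site d) : effCornerLog L k W U' u z ∈ skewAdjoint (Matrix n n ℂ) :=
  (skewAdjoint _).sub_mem (cornerLog_skew k hu hcorner hhs z)
    (frameDefect_skew hL k hWu hx hs hWx N U' hWP hU'u hU'P hu huP hgauge hXs hd hα hα3 hα4 h52 hb hXb hsmall hc₃ hsm hαP hαP3 hαP2 hx' hU'x hx'P z)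

include hL hWu hx hs hWx hWP hU'u hU'P hu huP hgauge hXs in
/-- **`h̃(u)` IS `N`-PERIODIC**. [folklore] -/
theorem effCornerLog_periodic (z : Site d) (i : Fin d) : effCornerLog L k W U' u (z + (N : ℤ) • e i) = effCornerLog L k W U' u z := by
  simp only [effCornerLog, cornerLog_periodic k N huP z i, frameDefect_periodic hL k hWu hx hs hWx N U' hWP hU'u hU'P hu huP hgauge hXs z i]

include hL hWu hα hα3 hα4 h52 hb hXb hsmall hc₃ h100 hC16 in
/-- **`‖h̃(u)(z)‖ ≤ ‖h(u)(z)‖ + C_Γ·(M·b)²`**. [folklore] -/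
theorem norm_effCornerLog_le (z : Site d) :
    ‖effCornerLog L k W U' u z‖ ≤ ‖cornerLog L k u z‖ + (56 * ((d : ℝ) * L) ^ 2 + 16 * (131072 * ((d : ℝ) + 1) ^ 2) * ((d : ℝ) * L)) * ((L : ℝ) ^ (k + 1) * b) ^ 2 := by
  have h1 := norm_frameDefect_le hL k hWu U' hα hα3 hα4 h52 hb hXb hsmall hc₃ h100 hC16 z (u := u)
  have h2 : ‖cornerLog L k u z - frameDefect L k W U' u z‖ ≤ ‖cornerLog L k u z‖ + ‖frameDefect L k W U' u z‖ := norm_sub_le _ _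
  unfold effCornerLog
  linarith

/-! ## §2 Skewness, periodicity, exactness, the split, access letters — `NE7SliceIterationStateFacts` under `h ↦ h̃` -/

include hL hWu hx hs hWx hWP hU'u hU'P hu huP hgauge hXs hcorner hhs hd hα hα3 hα4 h52 hb hXb hsmall hc₃ hsm hαP hαP3 hαP2 hx' hU'x hx'P in
/-- **`φ̃(u)` IS SKEW AND `N`-PERIODIC** on the working region. [folklore] -/
theorem coarseDatumNL_skew_periodic : IsSkewDir (coarseDatumNL L k W U' u) ∧ IsPeriodicDir (coarseDatumNL L k W U' u) (N : ℤ) := by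
  have hL1 : 1 ≤ L := by omega
  have hX := dirIter_skew_periodic hL1 k hWu hWP hx hs hWx (repLog_skew hWu U' hU'u hu hgauge hXs) (repLog_periodic k N U' hWP hU'P huP)
  have hVu : IsUnitaryCfg (cavgIter L (k + 1) W) := (cavgIter_unitary_small hL1 k hWu hx hs hWx).1
  have hVP : IsPeriodicCfg (cavgIter L (k + 1) W) (N : ℤ) := isPeriodicCfg_cavgIter L N (k + 1) hWP
  have hg := gaugeDir_skew hVu (effCornerLog_skew hL k hWu hx hs hWx N U' hWP hU'u hU'P hu huP hgauge hXs hcorner hhs hd hα hα3 hα4 h52 hb hXb hsmall hc₃ hsm hαP hαP3 hαP2 hx' hU'x hx'P)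
  have hgP := isPeriodicDir_gaugeDir hVP (effCornerLog_periodic hL k hWu hx hs hWx N U' hWP hU'u hU'P hu huP hgauge hXs)
  exact ⟨fun z κ => (skewAdjoint _).sub_mem (hX.1 z κ) (hg z κ), fun z i κ => by simp only [coarseDatumNL, hX.2 z i κ, hgP z i κ]⟩

include hWP hU'u hU'P hu huP hgauge hXs hcorner hhs hd hα hα3 hα4 h52 hb hXb hsmall hc₃ hsm hαP hαP3 hαP2 hx' hU'x hx'P in
/-- **`T̃(u)` IS SKEW** on the working region. [folklore] -/
theorem tangentPartNL_skew : IsSkewDir (tangentPartNL hL k hWu hx hs hWx N hθ U' u) := by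
  have hφ := (coarseDatumNL_skew_periodic hL k hWu hx hs hWx N U' hWP hU'u hU'P hu huP hgauge hXs hcorner hhs hd hα hα3 hα4 h52 hb hXb hsmall hc₃ hsm hαP hαP3 hαP2 hx' hU'x hx'P).1
  intro y κ
  simp only [tangentPartNL, normalPartNL_eq hL k hWu hx hs hWx N hθ U' hφ]
  exact (skewAdjoint _).sub_mem (repLog_skew hWu U' hU'u hu hgauge hXs y κ) (isSkewDir_rightInvW hL k hWu hx hs hWx hθ hφ y κ)

include hWP hU'u hU'P hu huP hgauge hXs hcorner hhs hd hα hα3 hα4 h52 hb hXb hsmall hc₃ hsm hαP hαP3 hαP2 hx' hU'x hx'P in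
/-- **`T̃(u)` IS `(tower)`-PERIODIC** on the working region. [folklore] -/
theorem tangentPartNL_periodic : IsPeriodicDir (tangentPartNL hL k hWu hx hs hWx N hθ U' u) ((tower L N (k + 1) : ℕ) : ℤ) := by
  have hφ := (coarseDatumNL_skew_periodic hL k hWu hx hs hWx N U' hWP hU'u hU'P hu huP hgauge hXs hcorner hhs hd hα hα3 hα4 h52 hb hXb hsmall hc₃ hsm hαP hαP3 hαP2 hx' hU'x hx'P).1
  intro y i μ
  simp only [tangentPartNL, normalPartNL_eq hL k hWu hx hs hWx N hθ U' hφ, repLog_periodic k N U' hWP hU'P huP y i μ,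
    isPeriodicDir_rightInvW hL k hWu hWP hx hs hWx hθ hφ y i μ]

include hWP hU'u hU'P hu huP hgauge hXs hcorner hhs hd hα hα3 hα4 h52 hb hXb hsmall hc₃ hsm hαP hαP3 hαP2 hx' hU'x hx'P in
/-- **`dirIter T̃(u) = gaugeDir_V h̃(u)`** on the working region (`rightInvW` is an exact right inverse). [folklore] -/
theorem dirIter_tangentPartNL :
    dirIter L (k + 1) W (tangentPartNL hL k hWu hx hs hWx N hθ U' u) = gaugeDir (cavgIter L (k + 1) W) (effCornerLog L k W U' u) := by
  have hL1 : 1 ≤ L := by omega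
  have hφ := coarseDatumNL_skew_periodic hL k hWu hx hs hWx N U' hWP hU'u hU'P hu huP hgauge hXs hcorner hhs hd hα hα3 hα4 h52 hb hXb hsmall hc₃ hsm hαP hαP3 hαP2 hx' hU'x hx'P
  have e : tangentPartNL hL k hWu hx hs hWx N hθ U' u = fun y κ => repLog W U' u y κ - rightInvW hL k hWu hx hs hWx N hθ hφ.1 y κ := by
    funext y κ; simp only [tangentPartNL, normalPartNL_eq hL k hWu hx hs hWx N hθ U' hφ.1]
  rw [e, dirIter_sub hL1 k hWu hx hs hWx, dirIter_rightInvW hL k hWu hWP hx hs hWx hθ hφ.1 hφ.2]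
  funext z κ
  simp only [coarseDatumNL, sub_sub_cancel]

include hWP hU'u hU'P hu huP hgauge hXs hcorner hhs hd hα hα3 hα4 h52 hb hXb hsmall hc₃ hsm hαP hαP3 hαP2 hx' hU'x hx'P in
/-- **THE NORMALISED SPLIT OF `(T̃(u), h̃(u))` EXISTS** on the working region. [folklore] -/
theorem splitNL_exists : ∃ p : (Site d → Matrix n n ℂ) × (Site d → Fin d → Matrix n n ℂ),
    IsNormalisedSplit L k N W (tangentPartNL hL k hWu hx hs hWx N hθ U' u) (effCornerLog L k W U' u) p.1 p.2 := by
  obtain ⟨ζ, Y, hζs, hζP, hY, hsplit, hmean, -⟩ := exists_fullGauge_split_sized hL k hWu hWP hx hs hWx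
    (tangentPartNL_skew hL k hWu hx hs hWx N hθ U' hWP hU'u hU'P hu huP hgauge hXs hcorner hhs hd hα hα3 hα4 h52 hb hXb hsmall hc₃ hsm hαP hαP3 hαP2 hx' hU'x hx'P)
    (tangentPartNL_periodic hL k hWu hx hs hWx N hθ U' hWP hU'u hU'P hu huP hgauge hXs hcorner hhs hd hα hα3 hα4 h52 hb hXb hsmall hc₃ hsm hαP hαP3 hαP2 hx' hU'x hx'P)
    (effCornerLog_skew hL k hWu hx hs hWx N U' hWP hU'u hU'P hu huP hgauge hXs hcorner hhs hd hα hα3 hα4 h52 hb hXb hsmall hc₃ hsm hαP hαP3 hαP2 hx' hU'x hx'P)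
    (effCornerLog_periodic hL k hWu hx hs hWx N U' hWP hU'u hU'P hu huP hgauge hXs)
    (dirIter_tangentPartNL hL k hWu hx hs hWx N hθ U' hWP hU'u hU'P hu huP hgauge hXs hcorner hhs hd hα hα3 hα4 h52 hb hXb hsmall hc₃ hsm hαP hαP3 hαP2 hx' hU'x hx'P)
  exact ⟨(ζ, Y), hζs, hζP, hY, hsplit, hmean⟩

include hWP hU'u hU'P hu huP hgauge hXs hcorner hhs hd hα hα3 hα4 h52 hb hXb hsmall hc₃ hsm hαP hαP3 hαP2 hx' hU'x hx'P in
/-- the chosen `(ζ̃(u), Ỹ(u))` IS a normalised split of `(T̃(u), h̃(u))` on the working region. [folklore] -/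
theorem splitNL_holds : IsNormalisedSplit L k N W (tangentPartNL hL k hWu hx hs hWx N hθ U' u) (effCornerLog L k W U' u)
    (gaugeFunNL hL k hWu hx hs hWx N hθ U' u) (slicePartNL hL k hWu hx hs hWx N hθ U' u) :=
  splitNL_spec hL k hWu hx hs hWx N hθ U'
    (splitNL_exists hL k hWu hx hs hWx N hθ U' hWP hU'u hU'P hu huP hgauge hXs hcorner hhs hd hα hα3 hα4 h52 hb hXb hsmall hc₃ hsm hαP hαP3 hαP2 hx' hU'x hx'P)

include hWP hU'u hU'P hu huP hgauge hXs hcorner hhs hd hα hα3 hα4 h52 hb hXb hsmall hc₃ hsm hαP hαP3 hαP2 hx' hU'x hx'P in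
/-- the mismatch integrand `z ↦ framePotW T̃(u) z − h̃(u) z` is `N`-periodic on the working region. [folklore] -/
theorem frameNL_periodic (z : Site d) (i : Fin d) :
    framePotW L (k + 1) W (tangentPartNL hL k hWu hx hs hWx N hθ U' u) (z + (N : ℤ) • e i) - effCornerLog L k W U' u (z + (N : ℤ) • e i)
      = framePotW L (k + 1) W (tangentPartNL hL k hWu hx hs hWx N hθ U' u) z - effCornerLog L k W U' u z := by
  rw [framePotW_add_period L k hWP (tangentPartNL_periodic hL k hWu hx hs hWx N hθ U' hWP hU'u hU'P hu huP hgauge hXs hcorner hhs hd hα hα3 hα4 h52 hb hXb hsmall hc₃ hsm hαP hαP3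
    hαP2 hx' hU'x hx'P) z i, effCornerLog_periodic hL k hWu hx hs hWx N U' hWP hU'u hU'P hu huP hgauge hXs z i]

include hWP hU'u hU'P hu huP hgauge hXs hcorner hhs hd hα hα3 hα4 h52 hb hXb hsmall hc₃ hsm hαP hαP3 hαP2 hx' hU'x hx'P in
/-- **`‖framePotW T̃(u) z − h̃(u) z‖ ≤ m̃(u)`** everywhere. [folklore] -/
theorem norm_frame_le_frameMismatchNL (z : Site d) :
    ‖framePotW L (k + 1) W (tangentPartNL hL k hWu hx hs hWx N hθ U' u) z - effCornerLog L k W U' u z‖ ≤ frameMismatchNL hL k hWu hx hs hWx N hθ U' u :=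
  le_siteSup (Nat.one_le_iff_ne_zero.mpr (NeZero.ne N)) (f := fun z => ‖framePotW L (k + 1) W (tangentPartNL hL k hWu hx hs hWx N hθ U' u) z - effCornerLog L k W U' u z‖)
    (fun x κ => by simp only [frameNL_periodic hL k hWu hx hs hWx N hθ U' hWP hU'u hU'P hu huP hgauge hXs hcorner hhs hd hα hα3 hα4 h52 hb hXb hsmall hc₃ hsm hαP hαP3 hαP2 hx' hU'x hx'P x κ]) z

include hWP hU'u hU'P hu huP hgauge hXs hcorner hhs hd hα hα3 hα4 h52 hb hXb hsmall hc₃ hsm hαP hαP3 hαP2 hx' hU'x hx'P in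
/-- **`‖gaugeDir W ζ̃(u) y μ‖ ≤ δ̃(u)`** everywhere. [folklore] -/
theorem norm_gaugeDir_gaugeFunNL_le (y : Site d) (μ : Fin d) :
    ‖gaugeDir W (gaugeFunNL hL k hWu hx hs hWx N hθ U' u) y μ‖
      ≤ bondSup (tower L N (k + 1)) (fun y μ => ‖gaugeDir W (gaugeFunNL hL k hWu hx hs hWx N hθ U' u) y μ‖) := by
  haveI : NeZero L := ⟨by omega⟩
  have hsp := splitNL_holds hL k hWu hx hs hWx N hθ U' hWP hU'u hU'P hu huP hgauge hXs hcorner hhs hd hα hα3 hα4 h52 hb hXb hsmall hc₃ hsm hαP hαP3 hαP2 hx' hU'x hx'P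
  have hP := isPeriodicDir_gaugeDir hWP hsp.2.1
  exact le_bondSup (Nat.one_le_iff_ne_zero.mpr (NeZero.ne _)) (F := fun y μ => ‖gaugeDir W (gaugeFunNL hL k hWu hx hs hWx N hθ U' u) y μ‖)
    (fun x κ μ => by simp only [hP x κ μ]) y μ

/-- `δ̃(u) ≤ D̃f(u)`. [folklore] -/
theorem delta_le_sliceDefectNL (u : Site d → (Matrix n n ℂ)ˣ) :
    bondSup (tower L N (k + 1)) (fun y μ => ‖gaugeDir W (gaugeFunNL hL k hWu hx hs hWx N hθ U' u) y μ‖) ≤ sliceDefectNL hL k hWu hx hs hWx N hθ U' u := by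
  have hM : 0 < (L : ℝ) ^ (k + 1) := pow_pos (by exact_mod_cast (by omega : 0 < L)) _
  exact le_add_of_nonneg_right (div_nonneg (siteSup_nonneg fun z => norm_nonneg _) hM.le)

include hWP hU'u hU'P hu huP hgauge hXs hcorner hhs hd hα hα3 hα4 h52 hb hXb hsmall hc₃ hsm hαP hαP3 hαP2 hx' hU'x hx'P in
/-- **THE GAUGE FUNCTION IS SIZED BY THE DEFECT**: for Poincaré parameter `θ_P ≤ 1∕2`, `‖ζ̃(u) y‖ ≤ 6dM·D̃f(u)`. [folklore] -/
theorem norm_gaugeFunNL_le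
    (hθP : 4 * (d : ℝ) ^ 2 * ((L : ℝ) ^ (k + 1) - 1) ^ 2 * x + 16 * d * loopRad d L ((prop1Radius d L)^[k] x)
        + 4 * d * ((d : ℝ) - 1) * ((L : ℝ) ^ (k + 1) - 1) ^ 2 * x ≤ 1 / 2) (y : Site d) :
    ‖gaugeFunNL hL k hWu hx hs hWx N hθ U' u y‖ ≤ 6 * d * (L : ℝ) ^ (k + 1) * sliceDefectNL hL k hWu hx hs hWx N hθ U' u := by
  have hsp := splitNL_holds hL k hWu hx hs hWx N hθ U' hWP hU'u hU'P hu huP hgauge hXs hcorner hhs hd hα hα3 hα4 h52 hb hXb hsmall hc₃ hsm hαP hαP3 hαP2 hx' hU'x hx'P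
  obtain ⟨hζs, hζP, -, -, hmean⟩ := hsp
  have hm : ∀ z, ‖bmeanIterW L (k + 1) W (gaugeFunNL hL k hWu hx hs hWx N hθ U' u) z‖ ≤ frameMismatchNL hL k hWu hx hs hWx N hθ U' u := fun z => by
    rw [hmean z, norm_neg]
    exact norm_frame_le_frameMismatchNL hL k hWu hx hs hWx N hθ U' hWP hU'u hU'P hu huP hgauge hXs hcorner hhs hd hα hα3 hα4 h52 hb hXb hsmall hc₃ hsm hαP hαP3 hαP2 hx' hU'x hx'P z
  have hG := norm_gaugeDir_gaugeFunNL_le hL k hWu hx hs hWx N hθ U' hWP hU'u hU'P hu huP hgauge hXs hcorner hhs hd hα hα3 hα4 h52 hb hXb hsmall hc₃ hsm hαP hαP3 hαP2 hx' hU'x hx'P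
  haveI : NeZero L := ⟨by omega⟩
  have hP1 : 1 ≤ tower L N (k + 1) := Nat.one_le_iff_ne_zero.mpr (NeZero.ne _)
  have h := sup_le_of_bmeanIterW_le hL k hWu hx hs hWx (gaugeFunNL hL k hWu hx hs hWx N hθ U' u) hm hP1 hζP hG (lt_of_le_of_lt hθP (by norm_num)) y
  clear hm hG hζs hζP hWP hU'u hU'P hu huP hgauge hXs hcorner hhs hα hα3 hα4 h52 hXb hsmall hc₃ hsm hαP hαP3 hαP2 hU'x hx'P
  refine h.trans ?_
  obtain ⟨θP, hθPdef⟩ : ∃ t : ℝ, t = 4 * (d : ℝ) ^ 2 * ((L : ℝ) ^ (k + 1) - 1) ^ 2 * x + 16 * d * loopRad d L ((prop1Radius d L)^[k] x)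
      + 4 * d * ((d : ℝ) - 1) * ((L : ℝ) ^ (k + 1) - 1) ^ 2 * x := ⟨_, rfl⟩
  rw [← hθPdef] at hθP ⊢
  obtain ⟨M, hMdef⟩ : ∃ M : ℝ, M = (L : ℝ) ^ (k + 1) := ⟨_, rfl⟩
  rw [← hMdef]
  have hM1 : 1 ≤ M := hMdef ▸ one_le_pow₀ (by exact_mod_cast (by omega : 1 ≤ L))
  have hd1 : (1 : ℝ) ≤ d := by exact_mod_cast hd
  have hDf0 : 0 ≤ sliceDefectNL hL k hWu hx hs hWx N hθ U' u := sliceDefectNL_nonneg hL k hWu hx hs hWx N hθ U' u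
  have hδ0 : 0 ≤ bondSup (tower L N (k + 1)) (fun y μ => ‖gaugeDir W (gaugeFunNL hL k hWu hx hs hWx N hθ U' u) y μ‖) := bondSup_nonneg fun y μ => norm_nonneg _
  have hδ := delta_le_sliceDefectNL hL k hWu hx hs hWx N hθ U' u
  have hmM := frameMismatchNL_le_sliceDefectNL hL k hWu hx hs hWx N hθ U' u
  rw [← hMdef] at hmM
  have hnum0 : 0 ≤ frameMismatchNL hL k hWu hx hs hWx N hθ U' u
      + 2 * d * (M - 1) * bondSup (tower L N (k + 1)) (fun y μ => ‖gaugeDir W (gaugeFunNL hL k hWu hx hs hWx N hθ U' u) y μ‖) := by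
    have := siteSup_nonneg (P := N) (fun z => norm_nonneg (framePotW L (k + 1) W (tangentPartNL hL k hWu hx hs hWx N hθ U' u) z - effCornerLog L k W U' u z))
    have h2 : 0 ≤ 2 * d * (M - 1) := by nlinarith
    exact add_nonneg this (mul_nonneg h2 hδ0)
  have hden : (1 : ℝ) / 2 ≤ 1 - θP := by linarith
  calc (frameMismatchNL hL k hWu hx hs hWx N hθ U' u + 2 * d * (M - 1) * bondSup (tower L N (k + 1)) (fun y μ => ‖gaugeDir W (gaugeFunNL hL k hWu hx hs hWx N hθ U' u) y μ‖)) / (1 - θP)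
      ≤ (frameMismatchNL hL k hWu hx hs hWx N hθ U' u + 2 * d * (M - 1) * bondSup (tower L N (k + 1)) (fun y μ => ‖gaugeDir W (gaugeFunNL hL k hWu hx hs hWx N hθ U' u) y μ‖)) / (1 / 2) :=
        div_le_div_of_nonneg_left hnum0 (by norm_num) hden
    _ = 2 * frameMismatchNL hL k hWu hx hs hWx N hθ U' u
          + 4 * d * (M - 1) * bondSup (tower L N (k + 1)) (fun y μ => ‖gaugeDir W (gaugeFunNL hL k hWu hx hs hWx N hθ U' u) y μ‖) := by ring
    _ ≤ 2 * (M * sliceDefectNL hL k hWu hx hs hWx N hθ U' u) + 4 * d * (M - 1) * sliceDefectNL hL k hWu hx hs hWx N hθ U' u := by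
        have h2 : 0 ≤ 4 * d * (M - 1) := by nlinarith
        nlinarith [mul_le_mul_of_nonneg_left hδ h2]
    _ ≤ 6 * d * M * sliceDefectNL hL k hWu hx hs hWx N hθ U' u := by
        have h1 : M * sliceDefectNL hL k hWu hx hs hWx N hθ U' u ≤ d * (M * sliceDefectNL hL k hWu hx hs hWx N hθ U' u) :=
          le_mul_of_one_le_left (mul_nonneg (by linarith) hDf0) hd1
        have h2 : 4 * d * (M - 1) * sliceDefectNL hL k hWu hx hs hWx N hθ U' u ≤ 4 * d * M * sliceDefectNL hL k hWu hx hs hWx N hθ U' u := by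
          nlinarith [mul_nonneg (by linarith : (0 : ℝ) ≤ d) hDf0]
        nlinarith [h1, h2]

end Facts

end

end Summit.QuantumFields.BalabanUV.T4Continuum.NE7SliceIterationStateFactsNL
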